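import Summits.QuantumFields.BalabanUV.Beta.D1BFx.RoadEndBFxRoadScalesJ3S
import Summits.QuantumFields.BalabanUV.Beta.D1BFx.CoframeTableMassScales
import Summits.QuantumFields.BalabanUV.Beta.D1BFx.PackedRoadRowsMass

/-!
# Road «BF-x» — THE END AT THE ROAD's OBJECTS ON THE SCALES WITH THE LANES' INPUTS IN MASS CURRENCY: (C1)(C2) DISCHARGED, (J3) IN CLOSED FORM
# (junction file «PART 17-M»; unit `b2b-balaban-beta-d1-formalise-leaf-01`, gen 26)

HONEST DEPENDENCY (page 1, mandatory): continuum YM on T⁴ ⇐ BetaPertH ∧ nine spine estimates (0/9 proved); BetaPertH ⇐ (D1) ∧ (D4) ∧ CAP+tail;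
G-an2-4 gates asym, D1 and NE2/3/4.  HONEST FRAMING (cell contract, verbatim): «discharging `BetaPertH` makes Bałaban's UV stability UNCONDITIONAL — a real
constructive-QFT result; it is NOT the continuum limit and NOT the Clay problem.»  THIS FILE: [folklore] plumbing BY NAME, no estimate of Bałaban's; (K) NOT
closed — (J1), (J2) (+ `RJ2` rows), (C3) `hMRB hCB`, the GAP ROW `hGap`, the lanes' mass letters and floors are HYPOTHESES; 0 root-level binders of row D1
discharged (hW ∕ hR-sockets ∕ hSX-socket ∕ D1Tel ∕ D1Rep); NOT D1, NOT BetaPertH, NOT continuum, NOT Clay.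

WHAT IT SAYS.  The OWNER d1-p2 g20's PART 17 `RoadEndBFxRoadScalesC2S.d1Rep_BFx_road_scales_C2_sbpS` (the spine's `D1Rep` from road «BF-x» at the road's
objects on the scales `n = Lc^m`, (C1)(C2) discharged by leaf-03 g25's `exists_C1_letters` ∕ `exists_C2_letters`, (J3) in closed form by `GhostDeficitFormula.J3_closed_form`)
with the (K)-slot lanes' (L1)(L2) inputs RE-DISPLAYED IN MASS CURRENCY through this lineage's façade `PackedRoadRowsMass.road_sand_rows_mass ∕ road_blk_rows_mass`
(p334178): the END's «(L1) floor + units» `{δS₀ uS} hδS₀ hδS₀₂ huS` and «(L2) floor + units» `{uT} hδ₂₀₂ huT` are REPLACED by the literal's n-UNIFORM BLOCK-MASS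
LETTERS ON THE SCALES `{σS} {mS mB} hσS hSs hSm hBs hBm` (the (L2) separation floor `hδ₂₀` stays as the rate of `hBm`); every other binder is PART 17's, byte for byte;
conclusion `D1Rep Lc Jc N μ ν a SL k`.  WHY: an2 R-D1-g41-1 (4) located the END's units numbers `uS uT` as an artefact of the «envelope + floor + units» display
(`Zl(δS₀∕2n)² ≍ (n∕δS₀)⁸` against `cE = n⁴`); the mass display states the quantity the (L0) N-uniform propagator decay (in print, not in the tree) actually
delivers, with no units line (OWNER W-4 CLAIMS l.44843 «WANTED — THIS SHAPE»; INTENT-5 l.44984 «units uS uT (leaf-01's mass façade retires them)»).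
PROOF = PART 14's body run on the mass façade (cert J73-MASS a52386594751aa42) + PART 15's rate choice `σV := min (min σ₀ (κ₁₆₃∕4∕16)) σS` + PART 16's explicit
(J3) rest `(4N²n⁸ − 2)·PghQ n a (−1) n² a + 2·BR n` with its two row lemmas BY NAME + PART 17's (C2) `obtain` (cert J74-MASS 873b13faf37d7b05 ∕ c052873055eec1fe).
ABSOLUTE RULE (cell charter, verbatim): «No internally-minted statement may enter as a cited fact. Every hypothesis is either kernel-proved in this package or a
verbatim quotation of a PUBLISHED theorem with page reference. The manuscript(s) under audit are NOT citable for their own disputed steps — they are the thing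
under adjudication; programme-internal (2001/route/tribunal) claims are never citable.»  [B5] Prop. 1.2 ∕ (1.26)–(1.27) BY NAME (`h12 h126`).
No `def`, no `def … : Prop`, nothing cited as mathematics; 0 sorry.
-/

noncomputable section
open Finset Filter Topology Matrix
open scoped BigOperators Kronecker
open Literature.MathematicalPhysics.QuantumFieldTheory.Balaban1983to89
open Literature.MathematicalPhysics.QuantumFieldTheory.Balaban1983to89.Beta
open OneStepResolventKernel (JetData KInv Fib wsum LocStencil)
open OneStepKernelFamily (TbalOf TshotOf flipK D1Tel D1Rep KInvStep colH vertexOfK)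
open PolarizationSign (WardTransversal AxisReflectionCovariant)
open InterLevelTransport (onLat)
open BalabanStepJets (lamCoeffOf)
open AveragingHessianKernels (hessFF)
open KernelWard (divV)
open B12Sec2to5 (l1)
open DyadicShell (supNorm)
open ExpKernelCalculus (Site MKer BiLoc shiftK comp hessKer tadpole bubble)
open DecimatedMomentSummable (AbsMoment₂)
open Summit.QuantumFields.BalabanUV.Beta.TameKernelCalculus (Loc trK)
open Summit.QuantumFields.BalabanUV.Beta.D1BFx.ReducedKernel (TableR TOfRed)
open Summit.QuantumFields.BalabanUV.Beta.D1BFx.DressedTadpoleTable (tableRed)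
open Summit.QuantumFields.BalabanUV.Beta.D1BFx.ReducedKernelSandwich (fineHess)
open Summit.QuantumFields.BalabanUV.Beta.D1BFx.FineStencilBF (ffOf)
open Summit.QuantumFields.BalabanUV.Beta.D1BFx.FineStencilBFBalaban (SbfBal)
open Summit.QuantumFields.BalabanUV.Beta.D1BFx.SecondStencilBF (Wbf)
open Summit.QuantumFields.BalabanUV.Beta.D1BFx.GhostKernelComplete (PghQ absMoment₂_PghQ)
open Summit.QuantumFields.BalabanUV.Beta.D1BFx.GluonLeg (Ga)
open Summit.QuantumFields.BalabanUV.Beta.D1BFx.FrozenLegTails (nOf MOf hn1)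
open VectorTailsLoc (fam kfam)
open Literature.MathematicalPhysics.QuantumFieldTheory.Balaban1983to89.Beta.Composition (kkt)
open Summit.QuantumFields.BalabanUV.Beta.AxialDressingRooted (coDressKBmAt coProjBmAtK)
open Summit.QuantumFields.BalabanUV.Beta.D1BFx.SortedKernels (fTL fBL)
open Summit.QuantumFields.BalabanUV.Beta.D1BFx.PackedNSideDictionary (SN)
open Summit.QuantumFields.BalabanUV.Beta.D1BFx.PackedNSidePair (W2NInf)
open AffineAveraging (box toSite)
open SecondOrderResponse (vertex2OfK)
open Summit.QuantumFields.BalabanUV.Beta.D1BFx.FibredPeriodisation (periodiseF)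
open Summit.QuantumFields.BalabanUV.Beta.D1BFx.SortedPack (sortK)
open Summit.QuantumFields.BalabanUV.Beta.D1BFx.SortedReblocking (torusBlockEquiv)
open Summit.QuantumFields.BalabanUV.Beta.D1BFx.SortedEmbedding (e₁)
open Summit.QuantumFields.BalabanUV.Beta.D1BFx.PeriodicArrays (arr)
open Summit.QuantumFields.BalabanUV.Beta.D1BFx.TorusCombKKT (I J CombRows Khat Qhat)
open Summit.QuantumFields.BalabanUV.Beta.D1BFx.TorusGaugeBasis (What0)
open Summit.QuantumFields.BalabanUV.Beta.D1BFx.TorusGaugeBasisMatrix (Nhat)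
open Summit.QuantumFields.BalabanUV.Beta.D1BFx.TorusCoframeJets (Djet)
open Summit.QuantumFields.BalabanUV.Beta.D1BFx.GhostStencil (ghCur)
open Summit.QuantumFields.BalabanUV.Beta.D1BFx.TorusGhostPairStencils (gh₂)
open Summit.QuantumFields.BalabanUV.Beta.D1BFx.WardJetsFromNoether (oslot)
open Summit.QuantumFields.BalabanUV.Beta.D1BFx.ColourLiftAdE3 (c₃)
open Summit.QuantumFields.BalabanUV.Beta.D1BFx.PackedKernelSplit (blk ffW)
open Summit.QuantumFields.BalabanUV.Beta.D1BFx.ReducedKernelF (TOfLeg)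
open Summit.QuantumFields.BalabanUV.Beta.D1BFx.GhostLeg (Ggh)
open Summit.QuantumFields.BalabanUV.Beta.D1BFx.RoadEndBFxJunctionsS (d1Rep_BFx_of_junctions_sbpS)
open Summit.QuantumFields.BalabanUV.Beta.D1BFx.PackedRoadRestFamily (RoadIdx RkRoad Vgh Wgh wroad_eq_dite sum_RkRoad_of_neZero)
open Summit.QuantumFields.BalabanUV.Beta.D1BFx.PackedRoadRowsMass (road_sand_rows_mass road_blk_rows_mass)
open Summit.QuantumFields.BalabanUV.Beta.D1BFx.CoframeJetMassScales (exists_C1_letters)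
open B5Hk163Strip (kappa163_pos kappa163)
open Summit.QuantumFields.BalabanUV.Beta.D1BFx.RestKernelGhostRoad (decay510_ghostWordK_road KG_road_nonneg kappaG_road_pos)
open Summit.QuantumFields.BalabanUV.Beta.D1BFx.RestKernelFPSlotRoad (END_rows_RkFP_road)
open Summit.QuantumFields.BalabanUV.Beta.D1BFx.RestKernelGhostSlotJ (END_rows_RkGhJ)
open Summit.QuantumFields.BalabanUV.Beta.D1BFx.RestKernelSlotGlue (hMR_elim hRu_elim_zero)
open Summit.QuantumFields.BalabanUV.Beta.D1BFx.GhostStencilRooted (qAntiAt)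
open Summit.QuantumFields.BalabanUV.Beta.D1BFx.GhostStencilRootedReflection (ctrHalf)
open Summit.QuantumFields.BalabanUV.Beta.D1BFx.GhostAveragingSquare (qSqAt)
open Summit.QuantumFields.BalabanUV.Beta.D1BFx.GhostDeficitFormula (J3_closed_form)
open Summit.QuantumFields.BalabanUV.Beta.D1BFx.RoadEndBFxRoadScalesJ3S (absMoment₂_lin abs_secondMoment_lin_le)
open Summit.QuantumFields.BalabanUV.Beta.D1BFx.CoframeTableMassScales (exists_C2_letters)

namespace Summit.QuantumFields.BalabanUV.Beta.D1BFx.RoadEndBFxRoadScalesMassS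

variable {Lc : ℕ} [NeZero Lc] {a N cgh₀ : ℝ} {μ ν : Fin 4}
  {cE cVH cΛ cR cK cQ cE₂ cJ4 cΛ₂ cR₂ cQ₂ x₀ ωgl ωgh cgh : ℕ → ℝ} {WE WJ WΛ WR WQ : ℕ → TableR} {CE CJ CΛt CRt CQ δW : ℕ → ℝ}
  {TΛ WA : ℕ → Fin 4 → Site 4 → Fin 4 → Site 4 → MKer 4 (Fin 4)} {CT δT : ℕ → ℝ}
  {ε : ℕ → ℝ} {X : ℕ → Site 4 → MKer 4 (Fin 4)} {Cx δx : ℕ → ℝ}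

/-- [folklore] **ROAD BF-x ⟹ THE SPINE's `D1Rep`, AT THE ROAD's OBJECTS, ON THE SCALES — (C1)(C2) DISCHARGED, (J3) IN CLOSED FORM, THE LANES' (L1)(L2)
INPUTS IN MASS CURRENCY.**  The OWNER's PART 17 `RoadEndBFxRoadScalesC2S.d1Rep_BFx_road_scales_C2_sbpS` with `{δS₀ uS} hδS₀ hδS₀₂ huS` ∕ `{uT} hδ₂₀₂ huT` REPLACED by
the n-uniform block-mass letters on the scales `{σS} {mS mB} hσS hSs hSm hBs hBm` of `PackedRoadRowsMass`; everything else VERBATIM PART 17. -/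
theorem d1Rep_BFx_road_scales_mass_sbpS (Js : ℕ → JetData 3 Lc) (hμν : μ ≠ ν) (hN : N ≠ 0) (hL : 2 ≤ Lc) (hodd : Odd Lc)
    (ha : 0 < a)
    (h12 : B5.Prop12Printed (fam nOf hn1 MOf a ha)) (h126 : B5.Kernel126_127Printed (kfam nOf MOf))
    -- bridge B1 REPLACED: composite jet data, the printed symmetries of the flipped step kernels, the spine's `D1Tel`, the one-shot (K)-estimate
    (Jc : ∀ m : ℕ, JetData 3 (Lc ^ m))
    (hW : ∀ j, WardTransversal (flipK (TbalOf Lc Js j))) (hRfl : ∀ j, AxisReflectionCovariant (flipK (TbalOf Lc Js j)))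
    (htel : D1Tel Lc Js Jc)
    -- ===== THE (K) SLOT AT THE ROAD's OBJECTS (PART 10 `PackedRoadHptwScales.hptw_of_junctions`): per-scale block roots, the literal's stencil
    -- ===== families with their STRUCTURAL SOCKETS, torus sequences, per-bond torus pins, LIFTED [P1′]∕[P2′], and the junctions (J1)(J2)(J3)
    -- the block roots, per scale
    (r : ℕ → Fin 4 → ℕ) (hr : ∀ m : ℕ, r (m + 1) ∈ box (3 + 1) (m + 1))
    -- the literal's first-derivative stencil families, per scale, and their STRUCTURAL SOCKETS
    (S : ℕ → Fin 4 → (Fin 4 → ℤ) → MKer 4 (Fib 3)) {Cs δS : ℕ → ℝ} (hS : ∀ n : ℕ, 2 ≤ n → LocStencil (S n) (Cs n) (δS n))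
    (hCs : ∀ n, 0 ≤ Cs n) (hδS : ∀ n, 0 < δS n)
    (hScovB : ∀ n : ℕ, 2 ≤ n → ∀ κ' u t, S n κ' (u + ((n : ℕ) : ℤ) • t) = shiftK (-(((n : ℕ) : ℤ) • t)) (S n κ' u))
    (hSmm : ∀ n : ℕ, 2 ≤ n → ∀ κ' u x y (c b : Fin 4), S n κ' u x y (Sum.inr c) (Sum.inr b) = 0)
    (hSfm : ∀ n : ℕ, 2 ≤ n → ∀ κ' u x y (c b : Fin 4), S n κ' u x y (Sum.inl c) (Sum.inr b) = S n κ' u y x (Sum.inr b) (Sum.inl c))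
    (hSff : ∀ n : ℕ, 2 ≤ n → ∀ κ' u x y (c b : Fin 4), S n κ' u x y (Sum.inl c) (Sum.inl b) = -S n κ' u y x (Sum.inl b) (Sum.inl c))
    -- the literal's second-derivative stencil families, per scale, and their STRUCTURAL SOCKETS
    (S₂ : ℕ → Fin 4 → (Fin 4 → ℤ) → Fin 4 → (Fin 4 → ℤ) → MKer 4 (Fib 3)) {Ck δ₂ : ℕ → ℝ}
    (hS₂ : ∀ n : ℕ, 2 ≤ n → ∀ κ u κ' u', BiLoc (S₂ n κ u κ' u') u u (Ck n * Real.exp (-δ₂ n * l1 (u' - u))) (δ₂ n))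
    (hCk : ∀ n, 0 ≤ Ck n) (hδ₂ : ∀ n, 0 < δ₂ n)
    (hS₂covB : ∀ n : ℕ, 2 ≤ n → ∀ κ' κ'' u u' t, S₂ n κ' (u + ((n : ℕ) : ℤ) • t) κ'' (u' + ((n : ℕ) : ℤ) • t)
      = shiftK (-(((n : ℕ) : ℤ) • t)) (S₂ n κ' u κ'' u'))
    (hS₂mm : ∀ n : ℕ, 2 ≤ n → ∀ κ u κ' u' x y (c b : Fin 4), S₂ n κ u κ' u' x y (Sum.inr c) (Sum.inr b) = 0)
    (hS₂fm : ∀ n : ℕ, 2 ≤ n → ∀ κ u κ' u' x y (c b : Fin 4),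
      S₂ n κ u κ' u' x y (Sum.inl c) (Sum.inr b) = -S₂ n κ u κ' u' y x (Sum.inr b) (Sum.inl c))
    (hS₂ff : ∀ n : ℕ, 2 ≤ n → ∀ κ u κ' u' x y (c b : Fin 4),
      S₂ n κ u κ' u' x y (Sum.inl c) (Sum.inl b) = S₂ n κ u κ' u' y x (Sum.inl b) (Sum.inl c))
    -- the torus sequences, per scale
    (p : ℕ → ℕ → ℕ) [∀ n k, NeZero (p n k)] (hp : ∀ n, Tendsto (p n) atTop atTop)
    -- the literal's per-bond torus data, per scale, PINNED to the periodised single-bond ∕ pair stencil arrays and THE CONVENTION's generator jets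
    (K₁ : ∀ (n : ℕ) [NeZero n] (k : ℕ), I 3 n (p n k) ⊕ J 3 (p n k) → Matrix (I 3 n (p n k)) (I 3 n (p n k)) ℝ)
    (Q₁ : ∀ (n : ℕ) [NeZero n] (k : ℕ), I 3 n (p n k) ⊕ J 3 (p n k) → Matrix (J 3 (p n k)) (I 3 n (p n k)) ℝ)
    (x₁ : ∀ (n : ℕ) [NeZero n] (k : ℕ), I 3 n (p n k) ⊕ J 3 (p n k) → Matrix (I 3 n (p n k)) (CombRows (toSite (r n)) n (p n k)) ℝ)
    (K₂ : ∀ (n : ℕ) [NeZero n] (k : ℕ), I 3 n (p n k) ⊕ J 3 (p n k) → I 3 n (p n k) ⊕ J 3 (p n k) → Matrix (I 3 n (p n k)) (I 3 n (p n k)) ℝ)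
    (Q₂ : ∀ (n : ℕ) [NeZero n] (k : ℕ), I 3 n (p n k) ⊕ J 3 (p n k) → I 3 n (p n k) ⊕ J 3 (p n k) → Matrix (J 3 (p n k)) (I 3 n (p n k)) ℝ)
    (x₂ : ∀ (n : ℕ) [NeZero n] (k : ℕ), I 3 n (p n k) ⊕ J 3 (p n k) → I 3 n (p n k) ⊕ J 3 (p n k) →
      Matrix (I 3 n (p n k)) (CombRows (toSite (r n)) n (p n k)) ℝ)
    (hK₁ : ∀ n : ℕ, 2 ≤ n → ∀ [NeZero n], ∀ k i, K₁ n k (Sum.inl i) = Matrix.of (periodiseF (p n k) (fTL (sortK n (arr (n * p n k)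
      (S n i.2.2 (windowMap 4 (n * p n k) (torusBlockEquiv n (p n k) (i.1, i.2.1)))))))))
    (hQ₁ : ∀ n : ℕ, 2 ≤ n → ∀ [NeZero n], ∀ k i, Q₁ n k (Sum.inl i) = Matrix.of (periodiseF (p n k) (fBL (sortK n (arr (n * p n k)
      (S n i.2.2 (windowMap 4 (n * p n k) (torusBlockEquiv n (p n k) (i.1, i.2.1)))))))))
    (hx₁ : ∀ n : ℕ, 2 ≤ n → ∀ [NeZero n], ∀ k i, x₁ n k (Sum.inl i) = (Djet (n * p n k) (e₁ n (p n k) i)).submatrix (e₁ n (p n k)) id * Nhat (r n) n (p n k))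
    (hK₂ : ∀ n : ℕ, 2 ≤ n → ∀ [NeZero n], ∀ k i j, K₂ n k (Sum.inl i) (Sum.inl j) = Matrix.of (periodiseF (p n k) (fTL (sortK n (fun x y c b => ∑' t : Fin 4 → ℤ,
      arr (n * p n k) (S₂ n i.2.2 (windowMap 4 (n * p n k) (torusBlockEquiv n (p n k) (i.1, i.2.1))) j.2.2
        (imageShift (n * p n k) (windowMap 4 (n * p n k) (torusBlockEquiv n (p n k) (j.1, j.2.1))) t)) x y c b)))))
    (hQ₂ : ∀ n : ℕ, 2 ≤ n → ∀ [NeZero n], ∀ k i j, Q₂ n k (Sum.inl i) (Sum.inl j) = Matrix.of (periodiseF (p n k) (fBL (sortK n (fun x y c b => ∑' t : Fin 4 → ℤ,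
      arr (n * p n k) (S₂ n i.2.2 (windowMap 4 (n * p n k) (torusBlockEquiv n (p n k) (i.1, i.2.1))) j.2.2
        (imageShift (n * p n k) (windowMap 4 (n * p n k) (torusBlockEquiv n (p n k) (j.1, j.2.1))) t)) x y c b)))))
    (hx₂ : ∀ n : ℕ, 2 ≤ n → ∀ [NeZero n], ∀ k i j, x₂ n k (Sum.inl i) (Sum.inl j) = if i = j then x₁ n k (Sum.inl i) else 0)
    (hK₁0 : ∀ n : ℕ, 2 ≤ n → ∀ [NeZero n], ∀ k j, K₁ n k (Sum.inr j) = 0) (hQ₁0 : ∀ n : ℕ, 2 ≤ n → ∀ [NeZero n], ∀ k j, Q₁ n k (Sum.inr j) = 0)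
    (hx₁0 : ∀ n : ℕ, 2 ≤ n → ∀ [NeZero n], ∀ k j, x₁ n k (Sum.inr j) = 0)
    (hK₂0 : ∀ n : ℕ, 2 ≤ n → ∀ [NeZero n], ∀ k j q, K₂ n k (Sum.inr j) q = 0) (hK₂0' : ∀ n : ℕ, 2 ≤ n → ∀ [NeZero n], ∀ k q j, K₂ n k q (Sum.inr j) = 0)
    (hQ₂0 : ∀ n : ℕ, 2 ≤ n → ∀ [NeZero n], ∀ k j q, Q₂ n k (Sum.inr j) q = 0) (hQ₂0' : ∀ n : ℕ, 2 ≤ n → ∀ [NeZero n], ∀ k q j, Q₂ n k q (Sum.inr j) = 0)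
    (hx₂0 : ∀ n : ℕ, 2 ≤ n → ∀ [NeZero n], ∀ k j q, x₂ n k (Sum.inr j) q = 0) (hx₂0' : ∀ n : ℕ, 2 ≤ n → ∀ [NeZero n], ∀ k q j, x₂ n k q (Sum.inr j) = 0)
    -- the literal's LIFTED table-level Ward identities [P1′]∕[P2′] in the `ad e₃` model (ρ-g16-1′), per torus
    (C : Fin 3 → Matrix (Fin 3) (Fin 3) ℝ) (hC : C 2 = c₃)
    (hP1 : ∀ n : ℕ, 2 ≤ n → ∀ [NeZero n], ∀ k, ∀ q : Fin 3 × (I 3 n (p n k) ⊕ J 3 (p n k)),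
      (C q.1 ⊗ₖ kkt (K₁ n k q.2) (Q₁ n k q.2))
          * ((1 : Matrix (Fin 3) (Fin 3) ℝ) ⊗ₖ Matrix.fromRows (What0 (r n) n (p n k)) (0 : Matrix (J 3 (p n k)) (CombRows (toSite (r n)) n (p n k)) ℝ))
      + ((1 : Matrix (Fin 3) (Fin 3) ℝ) ⊗ₖ kkt (Khat (d := 3) n (p n k)) (Qhat (d := 3) n (p n k)))
          * (C q.1 ⊗ₖ Matrix.fromRows (x₁ n k q.2) (0 : Matrix (J 3 (p n k)) (CombRows (toSite (r n)) n (p n k)) ℝ))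
      + oslot (fun q' : Fin 3 × (I 3 n (p n k) ⊕ J 3 (p n k)) =>
            C q'.1 ⊗ₖ Matrix.fromRows (x₁ n k q'.2) (0 : Matrix (J 3 (p n k)) (CombRows (toSite (r n)) n (p n k)) ℝ))
          (fun i => ((1 : Matrix (Fin 3) (Fin 3) ℝ) ⊗ₖ kkt (Khat (d := 3) n (p n k)) (Qhat (d := 3) n (p n k))) i q) = 0)
    (hP2 : ∀ n : ℕ, 2 ≤ n → ∀ [NeZero n], ∀ k, ∀ q q'' : Fin 3 × (I 3 n (p n k) ⊕ J 3 (p n k)),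
      ((C q.1 * C q''.1) ⊗ₖ kkt (K₂ n k q.2 q''.2) (Q₂ n k q.2 q''.2))
          * ((1 : Matrix (Fin 3) (Fin 3) ℝ) ⊗ₖ Matrix.fromRows (What0 (r n) n (p n k)) (0 : Matrix (J 3 (p n k)) (CombRows (toSite (r n)) n (p n k)) ℝ))
      + (C q.1 ⊗ₖ kkt (K₁ n k q.2) (Q₁ n k q.2))
          * (C q''.1 ⊗ₖ Matrix.fromRows (x₁ n k q''.2) (0 : Matrix (J 3 (p n k)) (CombRows (toSite (r n)) n (p n k)) ℝ))
      + (C q''.1 ⊗ₖ kkt (K₁ n k q''.2) (Q₁ n k q''.2))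
          * (C q.1 ⊗ₖ Matrix.fromRows (x₁ n k q.2) (0 : Matrix (J 3 (p n k)) (CombRows (toSite (r n)) n (p n k)) ℝ))
      + ((1 : Matrix (Fin 3) (Fin 3) ℝ) ⊗ₖ kkt (Khat (d := 3) n (p n k)) (Qhat (d := 3) n (p n k)))
          * ((C q.1 * C q''.1) ⊗ₖ Matrix.fromRows (x₂ n k q.2 q''.2) (0 : Matrix (J 3 (p n k)) (CombRows (toSite (r n)) n (p n k)) ℝ))
      + oslot (fun q' : Fin 3 × (I 3 n (p n k) ⊕ J 3 (p n k)) =>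
            C q'.1 ⊗ₖ Matrix.fromRows (x₁ n k q'.2) (0 : Matrix (J 3 (p n k)) (CombRows (toSite (r n)) n (p n k)) ℝ))
          (fun i => (C q''.1 ⊗ₖ kkt (K₁ n k q''.2) (Q₁ n k q''.2)) i q)
      + oslot (fun q' : Fin 3 × (I 3 n (p n k) ⊕ J 3 (p n k)) =>
            (C q''.1 * C q'.1) ⊗ₖ Matrix.fromRows (x₂ n k q''.2 q'.2) (0 : Matrix (J 3 (p n k)) (CombRows (toSite (r n)) n (p n k)) ℝ))
          (fun i => ((1 : Matrix (Fin 3) (Fin 3) ℝ) ⊗ₖ kkt (Khat (d := 3) n (p n k)) (Qhat (d := 3) n (p n k))) i q)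
      + oslot (fun p' : Fin 3 × (I 3 n (p n k) ⊕ J 3 (p n k)) =>
            (C q.1 * C p'.1) ⊗ₖ Matrix.fromRows (x₂ n k q.2 p'.2) (0 : Matrix (J 3 (p n k)) (CombRows (toSite (r n)) n (p n k)) ℝ))
          (fun i => ((1 : Matrix (Fin 3) (Fin 3) ℝ) ⊗ₖ kkt (Khat (d := 3) n (p n k)) (Qhat (d := 3) n (p n k))) i q'') = 0)
    -- (J1) S-LIT, per exponent: the spine's one-shot kernel at scale `Lc^m` IS the road's main M-side object (d1-p3's `JcOf`; displayed)
    (hJ1 : ∀ m : ℕ, 1 ≤ m → ∀ z : Site 4, TshotOf Lc Jc m μ ν z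
      = hessKer (coDressKBmAt (toSite (r (Lc ^ m))) (Lc ^ m) (KInvStep (d := 3) (Lc ^ m) 0))
          (vertexOfK (coDressKBmAt (toSite (r (Lc ^ m))) (Lc ^ m) (KInvStep (d := 3) (Lc ^ m) 0)) (Lc ^ m) (S (Lc ^ m)))
          (vertex2OfK (coDressKBmAt (toSite (r (Lc ^ m))) (Lc ^ m) (KInvStep (d := 3) (Lc ^ m) 0)) (Lc ^ m) (S₂ (Lc ^ m))) μ ν z)
    -- (J2) the (A2-N) TABLE dictionary AT THE END's LETTERS, per scale, with a rest KERNEL `RJ2 n` (an2's Q-DICT-N; displayed)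
    (RJ2 : ℕ → Fin 4 → Fin 4 → Site 4 → ℝ)
    (hJ2 : ∀ n : ℕ, 2 ≤ n → ∀ [NeZero n], ∀ z : Site 4,
      ((2 : ℝ)⁻¹) ^ 2 * TOfLeg n (Ga n a) (fun κ u => blk (coProjBmAtK (toSite (r n)) n (SN (n - 1) a (S n)) κ u) true true)
            (fun μ' y ν' y' => ((2 : ℝ)⁻¹)⁻¹ • ffW (W2NInf (n - 1) a (r n) (S₂ n)) μ' y ν' y') μ ν z
      = ωgl n * TOfRed n a (SbfBal n a (cE n) (cVH n) (cΛ n) (cR n) (cK n) (cQ n))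
          (tableRed n (Wbf (cE₂ n) (cJ4 n) (cΛ₂ n) (cR₂ n) (cQ₂ n) (WE n) (WJ n) (WΛ n) (WR n) (WQ n))) μ ν z + RJ2 n μ ν z)
    -- (J3): NO HYPOTHESIS — the junction holds with an explicit rest (`GhostDeficitFormula.J3_closed_form`); its rows are displayed below as (C3) + the GAP ROW
    -- ===== THE LANES' INPUTS ON THE SCALES after (C1): the (L1) FLOOR of the literal's first-stencil rate `hδS₀ hδS₀₂` and units inequality `huS`
    -- ===== (the rate `σV` of PART 14 is CHOSEN INSIDE, its (C1) letter `hTs hTm` is leaf-03 g25's `exists_C1_letters`), the (L2) floor ∕ units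
    -- ===== `hδ₂₀ hδ₂₀₂ huT`, the co-frame table rate `κc` and the DISPLAYED co-frame table letter (C2) on the scales (`hCs' hCm`); the comb-FP lane AND
    -- ===== the ghost lane take NO letter; the junction rests' rows below
    {σS δ₂₀ : ℝ} {mS mB : Bool → Bool → ℝ}
    (hσS : 0 < σS)
    (hSs : ∀ (k : ℕ), 1 ≤ k → ∀ (κ : Fin 4) (u : Fin 4 → ℤ) (j k' : Bool), Summable fun p : Site 4 × Site 4 =>
      ∑ g, ∑ f, |blk (S (Lc ^ k) κ u) j k' p.1 p.2 g f| * Real.exp (σS / ((Lc ^ k : ℕ) : ℝ) * (l1 (p.1 - u) + l1 (p.2 - u))))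
    (hSm : ∀ (k : ℕ), 1 ≤ k → ∀ (κ : Fin 4) (u : Fin 4 → ℤ) (j k' : Bool), ∑' p : Site 4 × Site 4,
      ∑ g, ∑ f, |blk (S (Lc ^ k) κ u) j k' p.1 p.2 g f| * Real.exp (σS / ((Lc ^ k : ℕ) : ℝ) * (l1 (p.1 - u) + l1 (p.2 - u))) ≤ mS j k')
    (hδ₂₀ : 0 < δ₂₀)
    (hBs : ∀ (k : ℕ), 1 ≤ k → ∀ (κ : Fin 4) (u : Fin 4 → ℤ) (κ' : Fin 4) (u' : Fin 4 → ℤ) (j i : Bool),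
      Summable fun p : Site 4 × Site 4 => ∑ g, ∑ f, |blk (S₂ (Lc ^ k) κ u κ' u') j i p.1 p.2 g f|)
    (hBm : ∀ (k : ℕ), 1 ≤ k → ∀ (κ : Fin 4) (u : Fin 4 → ℤ) (κ' : Fin 4) (u' : Fin 4 → ℤ) (j i : Bool),
      ∑' p : Site 4 × Site 4, ∑ g, ∑ f, |blk (S₂ (Lc ^ k) κ u κ' u') j i p.1 p.2 g f|
        ≤ mB j i * Real.exp (-(δ₂₀ / ((Lc ^ k : ℕ) : ℝ)) * l1 (u' - u)))
    -- (C2): NO HYPOTHESIS — leaf-03 g25's `CoframeTableMassScales.exists_C2_letters` (gan24-leaf-05 g54's δ4b) supplies `κc mC hκc hCs' hCm` inside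
    {CJ2 : ℝ}
    (hMR₂ : ∀ m : ℕ, 1 ≤ m → AbsMoment₂ (RJ2 (Lc ^ m) μ ν)) (hC₂ : ∀ m : ℕ, 1 ≤ m → |B12Beta.secondMoment (RJ2 (Lc ^ m)) μ ν| ≤ CJ2)
    -- (C3) the four `Q′`-words of the explicit (J3) rest, on the scales: absolutely summable (all channels) and `m`-uniformly bounded (1.22) second moments
    {CB Cgap : ℝ}
    (hMRB : ∀ m : ℕ, 1 ≤ m → ∀ c e : Fin 4, AbsMoment₂ (fun z : Site 4 =>
      ((1 / 2) * tadpole (Ggh (Lc ^ m) a) (∑ κ : Fin 4, ∑ l : Fin 4, wsum (colH (coDressKBmAt (toSite (r (Lc ^ m))) (Lc ^ m) (KInvStep (d := 3) (Lc ^ m) 0)) (Lc ^ m) c 0 κ)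
            (fun u => wsum (colH (coDressKBmAt (toSite (r (Lc ^ m))) (Lc ^ m) (KInvStep (d := 3) (Lc ^ m) 0)) (Lc ^ m) e z l)
              (fun v' => (-((-1) * a * (((Lc ^ m) : ℕ) : ℝ) ^ 4)) • qSqAt (ctrHalf (Lc ^ m)) (Lc ^ m) κ u l v')))
        - (1 / 2) * (bubble (Ggh (Lc ^ m) a)
              (∑ κ : Fin 4, wsum (colH (coDressKBmAt (toSite (r (Lc ^ m))) (Lc ^ m) (KInvStep (d := 3) (Lc ^ m) 0)) (Lc ^ m) c 0 κ) (fun u => ((((Lc ^ m) : ℕ) : ℝ) ^ 2) • ghCur κ u))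
              (∑ κ : Fin 4, wsum (colH (coDressKBmAt (toSite (r (Lc ^ m))) (Lc ^ m) (KInvStep (d := 3) (Lc ^ m) 0)) (Lc ^ m) e z κ) (fun u => a • qAntiAt (ctrHalf (Lc ^ m)) (Lc ^ m) κ u))
            + bubble (Ggh (Lc ^ m) a)
              (∑ κ : Fin 4, wsum (colH (coDressKBmAt (toSite (r (Lc ^ m))) (Lc ^ m) (KInvStep (d := 3) (Lc ^ m) 0)) (Lc ^ m) c 0 κ) (fun u => a • qAntiAt (ctrHalf (Lc ^ m)) (Lc ^ m) κ u))
              (∑ κ : Fin 4, wsum (colH (coDressKBmAt (toSite (r (Lc ^ m))) (Lc ^ m) (KInvStep (d := 3) (Lc ^ m) 0)) (Lc ^ m) e z κ) (fun u => ((((Lc ^ m) : ℕ) : ℝ) ^ 2) • ghCur κ u))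
            + bubble (Ggh (Lc ^ m) a)
              (∑ κ : Fin 4, wsum (colH (coDressKBmAt (toSite (r (Lc ^ m))) (Lc ^ m) (KInvStep (d := 3) (Lc ^ m) 0)) (Lc ^ m) c 0 κ) (fun u => a • qAntiAt (ctrHalf (Lc ^ m)) (Lc ^ m) κ u))
              (∑ κ : Fin 4, wsum (colH (coDressKBmAt (toSite (r (Lc ^ m))) (Lc ^ m) (KInvStep (d := 3) (Lc ^ m) 0)) (Lc ^ m) e z κ) (fun u => a • qAntiAt (ctrHalf (Lc ^ m)) (Lc ^ m) κ u))))))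
    (hCB : ∀ m : ℕ, 1 ≤ m → |B12Beta.secondMoment (fun (c e : Fin 4) (z : Site 4) =>
      ((1 / 2) * tadpole (Ggh (Lc ^ m) a) (∑ κ : Fin 4, ∑ l : Fin 4, wsum (colH (coDressKBmAt (toSite (r (Lc ^ m))) (Lc ^ m) (KInvStep (d := 3) (Lc ^ m) 0)) (Lc ^ m) c 0 κ)
            (fun u => wsum (colH (coDressKBmAt (toSite (r (Lc ^ m))) (Lc ^ m) (KInvStep (d := 3) (Lc ^ m) 0)) (Lc ^ m) e z l)
              (fun v' => (-((-1) * a * (((Lc ^ m) : ℕ) : ℝ) ^ 4)) • qSqAt (ctrHalf (Lc ^ m)) (Lc ^ m) κ u l v')))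
        - (1 / 2) * (bubble (Ggh (Lc ^ m) a)
              (∑ κ : Fin 4, wsum (colH (coDressKBmAt (toSite (r (Lc ^ m))) (Lc ^ m) (KInvStep (d := 3) (Lc ^ m) 0)) (Lc ^ m) c 0 κ) (fun u => ((((Lc ^ m) : ℕ) : ℝ) ^ 2) • ghCur κ u))
              (∑ κ : Fin 4, wsum (colH (coDressKBmAt (toSite (r (Lc ^ m))) (Lc ^ m) (KInvStep (d := 3) (Lc ^ m) 0)) (Lc ^ m) e z κ) (fun u => a • qAntiAt (ctrHalf (Lc ^ m)) (Lc ^ m) κ u))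
            + bubble (Ggh (Lc ^ m) a)
              (∑ κ : Fin 4, wsum (colH (coDressKBmAt (toSite (r (Lc ^ m))) (Lc ^ m) (KInvStep (d := 3) (Lc ^ m) 0)) (Lc ^ m) c 0 κ) (fun u => a • qAntiAt (ctrHalf (Lc ^ m)) (Lc ^ m) κ u))
              (∑ κ : Fin 4, wsum (colH (coDressKBmAt (toSite (r (Lc ^ m))) (Lc ^ m) (KInvStep (d := 3) (Lc ^ m) 0)) (Lc ^ m) e z κ) (fun u => ((((Lc ^ m) : ℕ) : ℝ) ^ 2) • ghCur κ u))
            + bubble (Ggh (Lc ^ m) a)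
              (∑ κ : Fin 4, wsum (colH (coDressKBmAt (toSite (r (Lc ^ m))) (Lc ^ m) (KInvStep (d := 3) (Lc ^ m) 0)) (Lc ^ m) c 0 κ) (fun u => a • qAntiAt (ctrHalf (Lc ^ m)) (Lc ^ m) κ u))
              (∑ κ : Fin 4, wsum (colH (coDressKBmAt (toSite (r (Lc ^ m))) (Lc ^ m) (KInvStep (d := 3) (Lc ^ m) 0)) (Lc ^ m) e z κ) (fun u => a • qAntiAt (ctrHalf (Lc ^ m)) (Lc ^ m) κ u))))) μ ν| ≤ CB)
    -- THE GHOST NORMALISATION GAP ROW (F-g20-1): the END's expected ghost main term minus the road's, `(4N²n⁸ − 2)·PghQ(unit ray)`, must have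
    -- `m`-uniformly bounded (1.22) second moment — `= (4N² − 2n⁻⁸)·(the uniform base-point average of the punctured full sums of the unit-ray fine ghost
    -- Hessian)` by `AssemblySlots.hF_PghQ_ray`; displayed, NOT asserted
    (hGap : ∀ m : ℕ, 1 ≤ m → |(4 * N ^ 2 * ((Lc ^ m : ℕ) : ℝ) ^ 8 - 2)
        * B12Beta.secondMoment (fun (c e : Fin 4) (z : Site 4) => PghQ (Lc ^ m) a (-1) (((Lc ^ m : ℕ) : ℝ) ^ 2) a c e z) μ ν| ≤ Cgap)
    -- the RESCALED loop-weight tie of reading (ii): displayed scalar family `s`, pinned `s n = n⁻²`; the normalisation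
    (s : ℕ → ℝ) (hs : ∀ n : ℕ, 2 ≤ n → s n = ((n : ℝ) ^ 2)⁻¹) (hωs : ∀ n : ℕ, 2 ≤ n → ωgh n * (s n * cK n) ^ 2 = -2 * (ωgl n * cE n ^ 2))
    (hlam : ∀ n : ℕ, 2 ≤ n → ωgl n * cE n ^ 2 = 2 * N ^ 2 * (n : ℝ) ^ 8)
    -- pins and the ray (the rows' letters)
    (hcE : ∀ n : ℕ, 2 ≤ n → cE n = (n : ℝ) ^ 4) (hRsgn : ∀ n : ℕ, 2 ≤ n → cR n = -cE n) (hJ4 : ∀ n : ℕ, cJ4 n = 0)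
    (hcgh : ∀ n : ℕ, |cgh n| ≤ cgh₀) (hKray : ∀ n : ℕ, cK n = cgh n * (n : ℝ) ^ 2) (hQray : ∀ n : ℕ, cQ n = cgh n * a) (hx : ∀ n : ℕ, x₀ n = -cgh n)
    -- slot-table sockets (the END's), covariance, bond swap; `hdiv` (the ghost Ward rows `hrowgh` are a THEOREM on the ray: discharged inside)
    (hδW : ∀ n, 0 < δW n)
    (hE : ∀ n κ u l u', BiLoc (WE n κ u l u') u u' (CE n) (δW n)) (hJ : ∀ n κ u l u', BiLoc (WJ n κ u l u') u u' (CJ n) (δW n))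
    (hΛ : ∀ n κ u l u', BiLoc (WΛ n κ u l u') u u' (CΛt n) (δW n)) (hR : ∀ n κ u l u', BiLoc (WR n κ u l u') u u' (CRt n) (δW n))
    (hQ : ∀ n κ u l u', BiLoc (WQ n κ u l u') u u' (CQ n) (δW n))
    (hEc : ∀ (n : ℕ) (κ : Fin 4) (u : Site 4) (l : Fin 4) (u' t : Site 4),
      WE n κ (u + (n : ℤ) • t) l (u' + (n : ℤ) • t) = shiftK (-((n : ℤ) • t)) (WE n κ u l u'))
    (hJc : ∀ (n : ℕ) (κ : Fin 4) (u : Site 4) (l : Fin 4) (u' t : Site 4),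
      WJ n κ (u + (n : ℤ) • t) l (u' + (n : ℤ) • t) = shiftK (-((n : ℤ) • t)) (WJ n κ u l u'))
    (hΛc : ∀ (n : ℕ) (κ : Fin 4) (u : Site 4) (l : Fin 4) (u' t : Site 4),
      WΛ n κ (u + (n : ℤ) • t) l (u' + (n : ℤ) • t) = shiftK (-((n : ℤ) • t)) (WΛ n κ u l u'))
    (hRc : ∀ (n : ℕ) (κ : Fin 4) (u : Site 4) (l : Fin 4) (u' t : Site 4),
      WR n κ (u + (n : ℤ) • t) l (u' + (n : ℤ) • t) = shiftK (-((n : ℤ) • t)) (WR n κ u l u'))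
    (hQc : ∀ (n : ℕ) (κ : Fin 4) (u : Site 4) (l : Fin 4) (u' t : Site 4),
      WQ n κ (u + (n : ℤ) • t) l (u' + (n : ℤ) • t) = shiftK (-((n : ℤ) • t)) (WQ n κ u l u'))
    (hEs : ∀ n κ u l u', WE n κ u l u' = WE n l u' κ u) (hJs : ∀ n κ u l u', WJ n κ u l u' = WJ n l u' κ u)
    (hΛs : ∀ n κ u l u', WΛ n κ u l u' = WΛ n l u' κ u) (hRs : ∀ n κ u l u', WR n κ u l u' = WR n l u' κ u)
    (hQs : ∀ n κ u l u', WQ n κ u l u' = WQ n l u' κ u)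
    (hdiv : ∀ n : ℕ, 2 ≤ n → ∀ [NeZero n], ∀ (l' : Fin 4) (u' u : Site 4), ∑ κ' : Fin 4,
      (fineHess n a (SbfBal n a (cE n) (cVH n) (cΛ n) (cR n) (cK n) (cQ n))
          (Wbf (cE₂ n) (cJ4 n) (cΛ₂ n) (cR₂ n) (cQ₂ n) (WE n) (WJ n) (WΛ n) (WR n) (WQ n)) κ' l' (u - Pi.single κ' 1) u'
        - fineHess n a (SbfBal n a (cE n) (cVH n) (cΛ n) (cR n) (cK n) (cQ n))
          (Wbf (cE₂ n) (cJ4 n) (cΛ₂ n) (cR₂ n) (cQ₂ n) (WE n) (WJ n) (WΛ n) (WR n) (WQ n)) κ' l' u u') = 0)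
    -- (LOCAL) slot-E support and units; slot-R envelope and units (the three local ghost bubbles are SUPPLIED under reading (ii))
    {ρE : ℕ} {δ₀ kE : ℝ} (hδ₀ : 0 < δ₀) (hδE : ∀ n, δ₀ ≤ δW n)
    (hsuppE : ∀ n κ u l u', ρE < supNorm (u - u') → WE n κ u l u' = 0)
    (hkE : ∀ n : ℕ, 2 ≤ n → |ωgl n * cE₂ n| * CE n ≤ kE * (n : ℝ) ^ 8)
    {CwR δR : ℕ → ℝ} {θR δ₀R kR : ℝ} (hθR : 0 < θR) (hδR : ∀ n, 0 < δR n) (hδ₀R : 0 < δ₀R) (hδRge : ∀ n : ℕ, δ₀R / n ≤ δR n) (hCwR : ∀ n, 0 ≤ CwR n)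
    (hWRenv : ∀ n κ u l u', BiLoc (WR n κ u l u') u u' (CwR n * Real.exp (-(θR / n) * supNorm (u - u'))) (δR n))
    (hkR : ∀ n : ℕ, 2 ≤ n → |ωgl n * cR₂ n| * CwR n * (n : ℝ) ^ 6 ≤ kR)
    -- (Λ) sockets and zero-momentum data
    (hδT : ∀ n, 0 < δT n)
    (hdec : ∀ n : ℕ, 2 ≤ n → ∀ [NeZero n], ∀ κ u l u', WΛ n κ u l u' =
      (∑ m : Fin 4, OneStepResolventKernel.wsum (onLat n (fun y => lamCoeffOf (KInv (N := n) (d := 3)) n m y l u'))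
          (fun v => onLat n (fun y => TΛ n m y κ u) v))
      + (∑ m : Fin 4, OneStepResolventKernel.wsum (onLat n (fun y => lamCoeffOf (KInv (N := n) (d := 3)) n m y κ u))
          (fun v => onLat n (fun y => TΛ n m y l u') v))
      + WA n κ u l u')
    (hTloc : ∀ (n : ℕ) m y κ u, BiLoc (TΛ n m y κ u) ((n : ℤ) • y) ((n : ℤ) • y) (CT n * Real.exp (-δT n * l1 ((n : ℤ) • y - u))) (δT n))
    (hWAa : ∀ n κ u l u', trK (WA n κ u l u') = -WA n κ u l u') (hWAl : ∀ n κ u l u', Loc (WA n κ u l u'))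
    (hTcov : ∀ (n : ℕ) m y κ u t, TΛ n m (y + t) κ (u + (n : ℤ) • t) = shiftK (-((n : ℤ) • t)) (TΛ n m y κ u))
    (hcΛ : ∀ n : ℕ, 2 ≤ n → cΛ n ≠ 0) (hε : ∀ n : ℕ, ε n = 1 ∨ ε n = -1) (hδx : ∀ n, 0 < δx n) (hX : ∀ n u, BiLoc (X n u) u u (Cx n) (δx n))
    (hW1 : ∀ n : ℕ, 2 ≤ n → ∀ [NeZero n], ∀ u,
      comp (comp (Ga n a) (divV (fun κ v => ε n • SbfBal n a (cE n) (cVH n) (cΛ n) (cR n) (cK n) (cQ n) κ v) u)) (Ga n a) =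
        comp (Ga n a) (X n u) - comp (X n u) (Ga n a))
    (hW2 : ∀ n : ℕ, 2 ≤ n → ∀ [NeZero n], ∀ (m : Fin 4) (u : Site 4),
      divV (fun κ v => (-(ε n * (cΛ₂ n / cΛ n))) • TΛ n m 0 κ v) u = comp (X n u) (ffOf (hessFF n m 0)) - comp (ffOf (hessFF n m 0)) (X n u))
    -- (N) slot Q's SOCKETS (the (A2) readout of `WQ`: a decaying bi-localisation envelope at a BLOCK-scale rate floor and its units line — T₈ ⟸ `NeedleTadpoleRowDecay`)
    {CwQ δQ : ℕ → ℝ} {θQ δ₀Q kQ : ℝ} (hθQ : 0 < θQ) (hδQ : ∀ n, 0 < δQ n) (hδ₀Q : 0 < δ₀Q) (hδQge : ∀ n : ℕ, δ₀Q / n ≤ δQ n) (hCwQ : ∀ n, 0 ≤ CwQ n)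
    (hWQenv : ∀ n κ u l u', BiLoc (WQ n κ u l u') u u' (CwQ n * Real.exp (-(θQ / n) * supNorm (u - u'))) (δQ n))
    (hkQ : ∀ n : ℕ, 2 ≤ n → |ωgl n * cQ₂ n| * CwQ n * (n : ℝ) ^ 6 ≤ kQ)
    -- base-point labels of the free one-shot side (the spine root's `hSL` ∕ `k`); the Literature's window data is discharged at `M := id`, `cc := 1`
    {L : Type*} {SL : Finset L} (hSL : SL.Nonempty) (k : L → Fin 4) :
    D1Rep Lc Jc N μ ν a SL k := by
  -- (C2) «TB4-W CO-FRAME TABLE, m-UNIFORM MASS» on the scales (leaf-03 g25 part 6, BY NAME, at the road's own roots)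
  obtain ⟨κc, hκc, mC, hC2⟩ := exists_C2_letters (L := Lc) (a := a) hL ha hr μ ν
  -- the per-scale root, for `n ≥ 2`
  have hr2 : ∀ n : ℕ, 2 ≤ n → r n ∈ box (3 + 1) n := fun n hn => by
    obtain ⟨m, rfl⟩ : ∃ m, n = m + 1 := ⟨n - 1, by omega⟩
    exact hr m
  -- (C1) on the scales (leaf-03 g25 part 5): the window `σ₀(Lc, a)`; the rate chosen inside, below `σ₀`, the [B5] strip constant and the displayed rate `σS`
  obtain ⟨σ₀, hσ₀, hC1⟩ := exists_C1_letters (L := Lc) (a := a) hL ha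
  have hκ : 0 < kappa163 4 / 4 / 16 := by have := kappa163_pos 4; positivity
  set σV : ℝ := min (min σ₀ (kappa163 4 / 4 / 16)) σS with hσVdef
  have hσV : 0 < σV := lt_min (lt_min hσ₀ hκ) hσS
  have hσVσ₀ : σV ≤ σ₀ := (min_le_left _ _).trans (min_le_left _ _)
  have hσVκ : σV ≤ kappa163 4 / 4 / 16 := (min_le_left _ _).trans (min_le_right _ _)
  have hσVσ : σV ≤ σS := min_le_right _ _
  obtain ⟨mT, hT⟩ := hC1 σV hσV.le hσVσ₀
  -- PART 14's body with the MASS façade: the lanes' rows on the subsequence from (L1-M)(L2-M) + (C1)(C2)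
  obtain ⟨kG, K, c, -, -, -, hMRs, hRus⟩ := road_sand_rows_mass (Lc := Lc) (S := S) (S₂ := S₂) (μ := μ) (ν := ν) ha hL h12 h126 hr hSs hSm hσV hσVκ
    hσVσ (fun k hk κ u => (hT k hk κ u).1) (fun k hk κ u => (hT k hk κ u).2) hS₂ hCk hδ₂ hδ₂₀ hBs hBm hκc (fun k hk z j i => (hC2 k hk z j i).1)
    (fun k hk z j i => (hC2 k hk z j i).2)
  obtain ⟨kG', K', c', -, -, -, hMRb, hRub⟩ := road_blk_rows_mass (Lc := Lc) (S := S) (S₂ := S₂) (μ := μ) (ν := ν) ha hL h12 h126 hr hSs hSm hσV hσVκ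
    hσVσ (fun k hk κ u => (hT k hk κ u).1) (fun k hk κ u => (hT k hk κ u).2) hS₂ hCk hδ₂ hδ₂₀ hBs hBm hκc (fun k hk z j i => (hC2 k hk z j i).1)
    (fun k hk z j i => (hC2 k hk z j i).2)
  obtain ⟨hMRf, hRuf, -, -, -⟩ := END_rows_RkFP_road (Lc := Lc) (𝓻 := r) (μ := μ) (ν := ν) hr
  rw [← wroad_eq_dite] at hMRf hRuf
  obtain ⟨hMRg, hRug, -, -, -⟩ := END_rows_RkGhJ (Lc := Lc) (ω := fun _ => (1 : ℝ)) (a := a) (𝒱 := Vgh r) (𝒲 := Wgh r) (μ := μ) (ν := ν) (Ω := 1)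
    (fun _ => by rw [abs_one]) (kappaG_road_pos ha) (fun _ => KG_road_nonneg ha) (fun m i => decay510_ghostWordK_road m (hr m) ha i μ ν)
  have hMR2 : ∀ (u : Unit) (m : ℕ), 1 ≤ m → AbsMoment₂ ((fun _ : Unit => RJ2) u (Lc ^ m) μ ν) := fun _ m hm => hMR₂ m hm
  have hRu2 : ∀ (u : Unit) (m : ℕ), 1 ≤ m →
      |B12Beta.secondMoment ((fun _ : Unit => RJ2) u (Lc ^ m)) μ ν - (fun (_ : Unit) (_ : ℕ) => (0 : ℝ)) u (Lc ^ m)| ≤ (fun _ : Unit => CJ2) u :=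
    fun _ m hm => by simpa using hC₂ m hm
  -- the explicit (J3) rest `(4N²n⁸ − 2)·PghQ(unit ray) + 2·BR n` (PART 16) and its rows from the GAP ROW and the (C3) row
  set R3 : ℕ → Fin 4 → Fin 4 → Site 4 → ℝ :=
      (fun n c e z => if hn0 : n = 0 then (0 : ℝ) else (haveI : NeZero n := ⟨hn0⟩;
        (4 * N ^ 2 * (n : ℝ) ^ 8 - 2) * PghQ n a (-1) ((n : ℝ) ^ 2) a c e z + 2 *
        ((1 / 2) * tadpole (Ggh n a) (∑ κ : Fin 4, ∑ l : Fin 4, wsum (colH (coDressKBmAt (toSite (r n)) n (KInvStep (d := 3) n 0)) n c 0 κ)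
              (fun u => wsum (colH (coDressKBmAt (toSite (r n)) n (KInvStep (d := 3) n 0)) n e z l)
                (fun v' => (-((-1) * a * ((n : ℕ) : ℝ) ^ 4)) • qSqAt (ctrHalf n) n κ u l v')))
          - (1 / 2) * (bubble (Ggh n a)
                (∑ κ : Fin 4, wsum (colH (coDressKBmAt (toSite (r n)) n (KInvStep (d := 3) n 0)) n c 0 κ) (fun u => (((n : ℕ) : ℝ) ^ 2) • ghCur κ u))
                (∑ κ : Fin 4, wsum (colH (coDressKBmAt (toSite (r n)) n (KInvStep (d := 3) n 0)) n e z κ) (fun u => a • qAntiAt (ctrHalf n) n κ u))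
              + bubble (Ggh n a)
                (∑ κ : Fin 4, wsum (colH (coDressKBmAt (toSite (r n)) n (KInvStep (d := 3) n 0)) n c 0 κ) (fun u => a • qAntiAt (ctrHalf n) n κ u))
                (∑ κ : Fin 4, wsum (colH (coDressKBmAt (toSite (r n)) n (KInvStep (d := 3) n 0)) n e z κ) (fun u => (((n : ℕ) : ℝ) ^ 2) • ghCur κ u))
              + bubble (Ggh n a)
                (∑ κ : Fin 4, wsum (colH (coDressKBmAt (toSite (r n)) n (KInvStep (d := 3) n 0)) n c 0 κ) (fun u => a • qAntiAt (ctrHalf n) n κ u))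
                (∑ κ : Fin 4, wsum (colH (coDressKBmAt (toSite (r n)) n (KInvStep (d := 3) n 0)) n e z κ) (fun u => a • qAntiAt (ctrHalf n) n κ u))))))
    with hR3
  have hJ3 : ∀ n : ℕ, 2 ≤ n → ∀ [NeZero n], ∀ z : Site 4,
      -(2 * hessKer (Ggh n a)
          (fun κ' v => (((n : ℕ) : ℝ) ^ 2) • (fun x y a b => ∑ κ : Fin 4,
            wsum (colH (coDressKBmAt (toSite (r n)) n (KInvStep (d := 3) n 0)) n κ' v κ) (ghCur κ) x y a b))
          (fun κ' v l v' => (((n : ℕ) : ℝ) ^ 2) • (fun x y a b => ∑ κ : Fin 4,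
            wsum (colH (coDressKBmAt (toSite (r n)) n (KInvStep (d := 3) n 0)) n κ' v κ)
              (fun u => fun x y a b => colH (coDressKBmAt (toSite (r n)) n (KInvStep (d := 3) n 0)) n l v' κ u * gh₂ κ u x y a b) x y a b)) μ ν z)
      = ωgh n * PghQ n a (x₀ n) (cK n) (cQ n) μ ν z + R3 n μ ν z := by
    intro n hn _ z
    have h := J3_closed_form (N := N) (cE := cE) (ωgl := ωgl) (ωgh := ωgh) (cgh := cgh) (s := s) n hn (hr2 n hn) ha hs hωs hlam hKray hQray hx μ ν z
    have hn0 : n ≠ 0 := by omega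
    simp only [hR3, dif_neg hn0]
    exact h
  have hMR3 : ∀ (u : Unit) (m : ℕ), 1 ≤ m → AbsMoment₂ ((fun _ : Unit => R3) u (Lc ^ m) μ ν) := fun _ m hm => by
    have hne : Lc ^ m ≠ 0 := NeZero.ne _
    simp only [hR3, dif_neg hne]
    exact absMoment₂_lin (absMoment₂_PghQ (Lc ^ m) a (-1) (((Lc ^ m : ℕ) : ℝ) ^ 2) a ha μ ν) (hMRB m hm μ ν) _
  have hRu3 : ∀ (u : Unit) (m : ℕ), 1 ≤ m →
      |B12Beta.secondMoment ((fun _ : Unit => R3) u (Lc ^ m)) μ ν - (fun (_ : Unit) (_ : ℕ) => (0 : ℝ)) u (Lc ^ m)| ≤ (fun _ : Unit => Cgap + 2 * CB) u :=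
    fun _ m hm => by
    have hne : Lc ^ m ≠ 0 := NeZero.ne _
    simp only [hR3, dif_neg hne, sub_zero]
    exact abs_secondMoment_lin_le (fun c e => absMoment₂_PghQ (Lc ^ m) a (-1) (((Lc ^ m : ℕ) : ℝ) ^ 2) a ha c e)
      (fun c e => hMRB m hm c e) _ μ ν (hGap m hm) (hCB m hm)
  exact d1Rep_BFx_of_junctions_sbpS (Ru := fun (_ : RoadIdx) (_ : ℕ) => (0 : ℝ)) (CU := fun _ => 0) Js hμν hN hL hodd ha h12 h126 Jc hW hRfl htel r
    (fun n hn _ => hr2 n hn)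
    S hS hCs hδS hScovB hSmm hSfm hSff S₂ hS₂ hCk hδ₂ hS₂covB hS₂mm hS₂fm hS₂ff p hp K₁ Q₁ x₁ K₂ Q₂ x₂ hK₁ hQ₁ hx₁ hK₂ hQ₂ hx₂ hK₁0 hQ₁0
    hx₁0 hK₂0 hK₂0' hQ₂0 hQ₂0' hx₂0 hx₂0' C hC hP1 hP2 hJ1 RJ2 R3 hJ2 hJ3 (RkRoad a r S S₂ RJ2 R3)
    (fun m _ z => sum_RkRoad_of_neZero a r S S₂ RJ2 R3 (Lc ^ m) μ ν z)
    (hMR_elim hMRs (hMR_elim hMRb (hMR_elim hMRf (hMR_elim hMR2 (hMR_elim hMR3 hMRg)))))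
    (hRu_elim_zero hRus (hRu_elim_zero hRub (hRu_elim_zero hRuf (hRu_elim_zero hRu2 (hRu_elim_zero hRu3 hRug)))))
    le_rfl s hs hωs hlam hcE hRsgn hJ4 hcgh hKray hQray hx hδW hE hJ hΛ hR hQ hEc hJc hΛc hRc hQc hEs hJs hΛs hRs hQs hdiv hδ₀ hδE hsuppE hkE hθR
    hδR hδ₀R hδRge hCwR hWRenv hkR hδT hdec hTloc hWAa hWAl hTcov hcΛ hε hδx hX hW1 hW2 hθQ hδQ hδ₀Q hδQge hCwQ hWQenv hkQ (fun n _ u => by simp) hSL k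

end Summit.QuantumFields.BalabanUV.Beta.D1BFx.RoadEndBFxRoadScalesMassS

end
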